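import Summits.BirchSwinnertonDyer.BirchSwinnertonDyer.Theorems.ClassRecordThreeCornerAtThreeKolyvaginRecord
import HarnessLib

/-!
# Crux idea (item stmt-BirchSwinnertonDyer-21420 `CornerAtThreeW`, shared by `ClassRecordThree` r7 /
# `KolyvaginRoadThree` r8): the mod-`𝔪` Kolyvagin system is an invariant of `ρ̄ = E[3]` under
# LEVEL-LOWERING AT `p = 3` ITSELF (cell `bsd-stepL`, seat `mult-idea` g17)

PLANNER SKETCH — elaborates on the farm, `sorry`-free; NOT a proposal, NOT a Theorems file; nothing is booked;
item 21420 does NOT close. Card: `idea-kolyvagin-transport-by-level-lowering-at-3.md` (to be filed on the crux by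
@plan, TURNKEY T-g17-1; this unit's `ledger idea add --crux` is one-writer refused).

## The line in one paragraph

On the corner (`(E,3) ∈` X11b: `3 ∥ N`, `E[3]` irreducible onto `N(C)`) the pair is ALWAYS finite at `3`
(`3 ∣ v₃(Δ)`, census 296/296) and on the Tamagawa-free sub-locus t0 ∩ 3Nn (42 pairs) NON-SPLIT at `3`
(`a₃(E) = −1`). So `ρ̄ = E[3]` is modular of level `N/3` (Ribet): there is a weight-2 newform `g` of level
`N/3`, GOOD ORDINARY NON-ANOMALOUS at `3` (`a₃(g) ≡ −1`), with `ρ̄_g ≅ ρ̄`. Let `𝔪 = (3, T_ℓ − a_ℓ(E), U₃ + 1)`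
in `𝕋(N)`. Because `det ρ̄ = ω` is ramified at `3` while the `U₃`-eigencharacter is unramified, `𝔪` is
`D₃`-DISTINGUISHED for free, so Wiles' multiplicity one (Thm. 2.1(ii); Tilouine, Thm. 3.4 in Cornell–Silverman–
Stevens p. 404: "if `p ∣ N` and `𝔐` is `G_p`-distinguished then `J[p]_𝔐` is free of rank 2 over `𝕋_𝔐/p`") makes
`T = Ta₃ J₀(N)_𝔪` free of rank 2 over `R = 𝕋(N)_𝔪` with `T/𝔪T ≅ ρ̄`. Kolyvagin's derivative construction runs
VERBATIM on the Heegner divisors `x(n)` of `X₀(N)` with `R`-coefficients (`(ℓ+1) − Tr_ℓ = (ℓ+1) − T_ℓ ∈ 𝔪`):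
ONE class `c̄(n) ∈ H¹(K, ρ̄)` per Kolyvagin conductor `n`, whose specialisation along `λ_E : R → ℤ₃` is
`c_E(n) mod 3` (Kummer functoriality for `π_E : J₀(N) → E`; `T ⊗_{λ_E} ℤ₃ = Ta₃E`) and along the `α`-stabilised
old character `λ_{g,α} : R → 𝒪_𝔭` (`U₃ ↦ α`, the unit root of `x² − a₃(g)x + 3`) is `(1 − α⁻¹)^k · c_g(n) mod 𝔭`
— the `3`-stabilisation factor, a UNIT exactly when `E` is NON-split at `3` (`α ≡ a₃(E) = −1`; for split `E`,
`α ≡ 1`, it vanishes: the exceptional-zero degeneration, cf. Skinner–Zhang's `𝓛`-invariant proviso in the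
non-finite case). Hence `c_E(n) ≢ 0 (mod 3) ⟺ c_g(n) ≢ 0 (mod 𝔭)` for every `n`: McCALLUM's `M_∞ = 0`
(the tree's `Koly.CertificateAt … 3 0`, = the route's Z₃ᶜ input at t0) IS AN INVARIANT OF `𝔪`
(§2 `KolyvaginTransportThree`, K1), and the multiplicative prime has disappeared: for `g` every machine that
(unr) `p ∤ N` locks out for `E` is available AT `p = 3` — Sweeting v3 Thm. A/E (`p = 3` allowed under ♦ = "not
induced from `ℚ(√−3)`", TRUE on 3Nn; weakly admissible primes `q ≡ 2 (mod 3)` replace BD-admissible ones, so the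
catalogued `NoAdmissiblePrimesAtThree` does not bite the companion), non-anomalous control (`#g̃(𝔽₃) = 5`), and the
Burungale–Castella–Grossi–Skinner refined-Kolyvagin argument `M_∞ = Σ ord₃ c_ℓ` whose `p > 3` provisos are
group-cohomological and vacuous for images of order prime to `3` (§3 `CompanionRefinedKolyvaginThree`, K2, the
located residual). §4 proves K1 ∧ K2 (+ the CM-theoretic existence of level-`N` Kolyvagin data, P2) ⟹ the
`hZ` binder (`M = 0`) of the tree's consumer `missingPPartAt_three_of_corner_of_refinedKolyvagin_of_cornerTwist`
on every odd Manin-good frame — INCLUDING the `3 ∣ Ш_an(E)` kernel where the unit-index cards (F, P) are empty.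
Nothing here uses `Surj`; K1 is stated for every irreducible `E[3]` (so it is numerically falsifiable on
thousands of non-corner curves too). Beyond-print theorem: NO (K1 = new combination of printed ingredients;
K2 = BCGS at `p = 3` with Sweeting's HPMC as input, PRE).

References: Wiles 1995 Thm. 2.1(ii) = Tilouine, "Hecke algebras and the Gorenstein property", Thm. 3.4
[corpus: book:cornell1997-modular-forms-fermats-last-theorem p0404]; Ribet 1990 (level lowering) / Ribet 1984
(Ihara, kernel of `J₀(M)² → J₀(Mp)` Eisenstein); Gross 1991 §3–4 (Kolyvagin's construction; McCallum 1991 §5,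
tree `KolyvaginLine.lean`); W. Zhang 2014 §3.7–3.8, Thm. 4.3 ("cohomological congruence of Heegner points",
level-RAISING direction, `p ∤ N`) [corpus: paper:doi-10-4310-cjm-2014-v2-n2-a2 p0025, p0028]; Skinner–Zhang
arXiv:1407.1099 Thm. 1.3 (multiplicative `p ≥ 5`, `E[p]` NOT finite at `p` — the complementary case; their
ingredient list p0004 is the template) ; Sweeting arXiv:2012.11771v3 Thm. A/E, Condition ♦, (unr)
[HOME/audit/SWEETING-V3-lit-g19.md]; BCGS arXiv:2312.09301 Thm. 2 (`p > 3`) [corpus: paper:arxiv-2312.09301 p0004].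
-/

noncomputable section

open scoped Classical

open WeierstrassCurve NumberField Literature.NumberTheory.EllipticCurves
  Literature.NumberTheory.EllipticCurves.ModularForms
  Literature.NumberTheory.EllipticCurves.Rank1Residual
  Literature.NumberTheory.EllipticCurves.Rank1Residual.Typed
  Summit.BirchSwinnertonDyer.Rank1Residual
  Summit.BirchSwinnertonDyer.Rank1Residual.X11b.Three
  Summit.BirchSwinnertonDyer.Rank1Residual.X11b.Three.Koly

namespace Summit.BirchSwinnertonDyer.BirchSwinnertonDyer.Cruxes.CornerAtThreeW.KolyvaginTransport

set_option linter.dupNamespace false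

instance fact_prime_three' : Fact (Nat.Prime 3) := ⟨Nat.prime_three⟩

/-! ### §1 The level-lowered companion (data-level, image-free predicate) -/

/-- **`G` is a level-lowered companion of `W` at `3`**: `N_W = 3·N_G` with `3 ∤ N_G` (so `3 ∥ N_W` and `G` is
good at `3`), `W` is NON-split multiplicative at `3` (the `3`-stabilisation factor `1 − α⁻¹ ≡ 2` is a unit; for
split `W` it vanishes), and `a_ℓ(W) ≡ a_ℓ(G) (mod 3)` at every prime `ℓ ∤ N_W` (so `ρ̄_W ≅ ρ̄_G` when
irreducible, and `a₃(G) ≡ a₃(W)·(unit root) ≡ −1`: `G` is ordinary non-anomalous at `3`) AND at every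
prime `ℓ ≠ 3` of bad reduction (the tree's `frobeniusTrace` at a bad prime is `1 + a_ℓ`, so this pins the SAME
local sign `a_q(W) = a_q(G) ∈ {0, ±1}` at `q ∣ N_G` — needed: at `q ∥ N_G`, `q ≡ 2 (mod 3)`, `ρ̄` unramified at
`q`, both signs occur in the `ρ̄`-class and opposite signs change `ord₃ c_q` and the local condition, so the
full Hecke algebra `𝕋(N_W)_𝔪` must see both eigencharacters). Existence for a corner pair = Ribet's level
lowering (`E[3]` finite at `3` iff `3 ∣ v₃(Δ)`: census 296/296) with matching signs + rationality of the
companion newform (per pair; else the `A_g` version, definition request D1). [folklore] -/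
def IsLevelLoweredCompanionAtThree (W G : WeierstrassCurve ℚ) [W.IsElliptic] [W.IsGloballyMinimal]
    [G.IsElliptic] [G.IsGloballyMinimal] : Prop :=
  W.conductorNorm ℤ = 3 * G.conductorNorm ℤ ∧ ¬ (3 ∣ G.conductorNorm ℤ) ∧
    Mult W 3 ∧ ¬ W.HasSplitMultiplicativeReductionAtPrime 3 ∧
    ∀ ℓ : ℕ, ℓ.Prime → ℓ ≠ 3 →
      ((W.frobeniusTrace ℓ : ℤ) : ZMod 3) = ((G.frobeniusTrace ℓ : ℤ) : ZMod 3)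

/-! ### §2 K1 (crux, rank 2): mod-`3` Kolyvagin certificates are invariants of `𝔪` -/

/-- **K1 · `KolyvaginTransportThree`** (crux, rank 2; NEW COMBINATION, not in print). For `W/ℚ` with `E[3]`
irreducible and a level-lowered companion `G` at `3` (§1), on every imaginary quadratic `K` Heegner for
`N_W` (hence for `N_G`, with `3` split), every orientation `β`, embedding `ι`, and conductor `n`: a level-`1`
(i.e. mod-`3`) McCallum certificate at `n` for `W` — `n ∈ S_r(1)` and `P_W(n) ∉ 3·E(K[n])` — holds IFF the same
certificate holds for `G`; both parametrisations MANIN-GOOD at `3` (`3 ∤ c`: the structure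
`ModularParametrizationData` admits the `[3]`-scaled parametrisation `c ↦ 3c`, for which `P(n) ∈ 3E(K[n])`
always — without `3 ∤ c` the iff is junk-false; with it, `c = m·c_min`, `3 ∤ m`, and `3`-divisibility of `P(n)`
is unchanged; Mazur: `3 ∤ c_min` since `9 ∤ 4N`). Mechanism: Wiles' multiplicity one at the `D₃`-distinguished
ideal `𝔪 = (3, T_ℓ − a_ℓ, U_q − a_q, U₃ + 1) ⊂ 𝕋(N_W)` (Tilouine: `p > 2`, `ord_p(N) ≤ 1`, `X = X₁(N)/H`) makes
`T = Ta₃J₀(N_W)_𝔪` free of rank 2 with `T/𝔪T ≅ ρ̄`; the derived Heegner divisor class `P_J(n) ∈ J₀(N_W)(K[n])`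
has Kummer image `κ̄(n) ∈ H¹(K[n], T/𝔪T)`, and `δ(P_W(n)) = π̄_W κ̄(n)`, `δ(P_G(n)) = Ψ̄ κ̄(n)` (unit `α − 1 ≡ −2`)
with `Ψ = α π_G δ₁,* − π_G δ₃,* ≡ −π_G(δ₁,* + δ₃,*) (mod 3)` the `U₃ = α` stabilised degeneracy map
(`δ₁,*U₃ = T₃δ₁,* − δ₃,*`, `δ₃,*U₃ = 3δ₁,*`; `δ₃x_N(n) = σ_𝔮·x_{N/3}(n)`, and `σP_G(n) ≡ P_G(n) mod 3` by Gross 3.6);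
`π̄_W`, `Ψ̄ : T/𝔪T → W[3], G[3]` are ISOMORPHISMS — `π̄_W ≠ 0` by optimality up to prime-to-3 isogeny (`Irr`),
`Ψ̄ ≠ 0` because the 3-old lattice `L_old ⊂ 𝔪T` (a proper `𝕋_𝔪[G_ℚ]`-sublattice, `f_W` being 3-new) has
`Ψ(L_old) ∋ (α² − 1)·Ta₃G` with `ord₃(α² − 1) = ord₃(α + 1) = 1` for rational `G` (`a₃ ∈ {−1, 2}`), so
`3Ta₃G ⊆ Ψ(𝔪T) ⊆ 3Ψ(T)` forces `Ψ(T) = Ta₃G`. Hence `P_W(n) ∈ 3W(K[n]) ⟺ κ̄(n) = 0 ⟺ P_G(n) ∈ 3G(K[n])`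
(Kummer maps injective; NO torsion hypothesis, the comparison is made over `K[n]`), and `Λ₁(W) = Λ₁(G)` since
`a_ℓ(W) ≡ a_ℓ(G)`. STATUS: a THEOREM SKETCH modulo the Literature fact (Wiles Thm. 2.1(ii) = Tilouine Thm. 3.4)
and the moduli identities for `δ₃` on Heegner points — port size L. WHY IT MIGHT FAIL: the `3`-stabilisation
unit must be computed honestly (done twice on paper: factor `α − 1`, unit iff NON-split; split `α ≡ 1` is the
exceptional-zero degeneration); multiplicity one is used at `p = 3` for an `𝔪` both `3`-old and `3`-new
(Tilouine's case 3: `p ∣ N`, `det = ω|I_p`, `G_p`-distinguished — automatic: ramified `ωχ` vs unramified `χ`);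
`Ψ`-primitivity as above uses `f_W` 3-new and `G` optimal up to prime-to-3 isogeny.
Sources: Tilouine Thm. 3.4 + setting [corpus: book:cornell1997-modular-forms-fermats-last-theorem p0404, p0403 L27, p0405 L63–68]; Gross 1991 §3–4 (Prop. 3.6);
W. Zhang 2014 §3.8 + Thm. 4.3 [corpus: paper:doi-10-4310-cjm-2014-v2-n2-a2 p0025/p0028]; Skinner–Zhang
arXiv:1407.1099 §§(multone),(coh cong) (non-finite analogue); Howard 2007 big Heegner points / Castella arXiv:1507.04260
(exceptional = split case) / Fornea 2014 (comparison at intersections of Hida families, tame-level version, `p ≥ 5`)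
[corpus: paper:w121950976 p0004, p0025]. [conjecture — crux idea g17, not in print] -/
@[conjecture] def KolyvaginTransportThree : Prop :=
  ∀ (W G : WeierstrassCurve ℚ) [W.IsElliptic] [W.IsGloballyMinimal] [G.IsElliptic] [G.IsGloballyMinimal],
    Irr W 3 → IsLevelLoweredCompanionAtThree W G →
    ∀ {N N' : ℕ} [NeZero N] [NeZero N'] (D : ModularParametrizationData W N)
      (D' : ModularParametrizationData G N') (K : Type) [Field K] [NumberField K],
      N = W.conductorNorm ℤ → N' = G.conductorNorm ℤ →
      IsImaginaryQuadratic K → SatisfiesHeegnerHypothesis N K → Odd (NumberField.discr K) →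
      ¬ (3 : ℤ) ∣ D.c → ¬ (3 : ℤ) ∣ D'.c →
      ∀ (β : ℤ) (ι : K →+* ℂ) (n r : ℕ) (d : KolyvaginHeegnerData D β ι n)
        (d' : KolyvaginHeegnerData D' β ι n),
        (MemS N W K 3 r 1 n ∧ ¬ PDiv d 3 1) ↔ (MemS N' G K 3 r 1 n ∧ ¬ PDiv d' 3 1)

/-! ### §3 K2 (crux, rank 3): refined Kolyvagin `M_∞ = 0` for the GOOD-ordinary companion at `p = 3` -/

/-- **K2 · `CompanionRefinedKolyvaginThree`** (crux, rank 3; the located residual — in substance THE crux of the line,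
since K1 is theorem-grade: W. Zhang's mod-`p` Kolyvagin theorem moved to `p = 3`, image `N(C_ns)`, Tamagawa-free).
For `G/ℚ` GOOD at `3`, ordinary NON-ANOMALOUS (`a₃(G) ≡ −1 (mod 3)`), `G[3]` irreducible and NOT surjective
(the corner's `N(C)` images), Tamagawa-free at `3` (`3 ∤ ∏ c_ℓ(G)`): on every imaginary quadratic `K` that is
Heegner for `3·N_G` (so Heegner for `N_G` with `3` SPLIT), `d_K` odd, orientation `β`, embedding `ι`, and
Manin-good parametrisation (`3 ∤ c`), McCallum's `M_∞ = 0`: a level-`1` certificate exists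
(`Koly.CertificateAt D' β ι 3 0`, rank-free). PRINT STATUS: W. Zhang 2014 Thm. 1.1 = exactly this mod-`p`
nonvanishing for `p ≥ 5`, `ρ̄` surjective, Hypothesis ♠; Sweeting arXiv:2012.11771v3 Thm. A allows `p = 3` and
non-surjective images under ♦ (abs. irreducible, not induced from `G_{ℚ(√−3)}` — true for `N(C_ns)`/3Nn, FALSE on
3Ns-a/b), with (unr) `3 ∤ 2N_G d_K` now true and WEAKLY admissible `q ≢ 1 (mod 3)` + ultrapatching, but concludes
only `c(m) ≠ 0 ∈ H¹(K, T_f/I_m)` and notes that mod-`𝔭` nonvanishing «is not the case in general» (Tamagawa: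
BCGS arXiv:2312.09301 Thm. 2, `M_∞ = Σ ord_p c_ℓ`, `p > 3`). Assembly from printed parts on RANK-1 frames:
Thm. A ⟹ Kolyvagin–McCallum structure theorem `#Ш[3^∞] = 3^{2(M_0 − M_∞)}` (Chebotarev steps at `N(C_ns)`:
irreducible + `H¹(ℚ(ρ̄)/ℚ, ρ̄) = 0`, free for order 16) and Thm. E (integral HPMC, `a₃` unit, `3` split, (sclr))
+ non-anomalous exact control ⟹ `3`-BSD formula for `A_g/K` in rank 1 ⟹ `M_∞ = M_0 − ½ord₃#Ш = 0`; on frames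
with `r_an(G/K) ≥ 3`: Zhang's rank induction with Sweeting's patched bipartite system. WHY IT MIGHT FAIL: the
mod-`𝔭` conclusion may be lost in the patching itself, not only to Tamagawa numbers; Zhang's ♠ wants `ρ̄` ramified
at every `q ∥ N_G` with `q ≡ ±1 (mod p)` — every `q` at `p = 3` — so the clean scope is `Mult(E) = {3}` (33/42 of
t0 ∩ 3Nn; companion level squarefull, `N⁻ = 1`); ♦ fails on 3Ns-a/b (K2 EMPTY there); Manin at `3` for `G`
(Mazur: `3 ∤ c` since `3 ∤ N_G`).
Sources: [corpus: paper:arxiv-2312.09301 p0003–p0004]; HOME/audit/SWEETING-V3-lit-g19.md §1–2;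
[corpus: paper:doi-10-4310-cjm-2014-v2-n2-a2 Thm. 1.1]. [conjecture — located residual of crux idea g17] -/
@[conjecture] def CompanionRefinedKolyvaginThree : Prop :=
  ∀ (G : WeierstrassCurve ℚ) [G.IsElliptic] [G.IsGloballyMinimal],
    Irr G 3 → ¬ Surj G 3 → ¬ (3 ∣ G.conductorNorm ℤ) →
    ((G.frobeniusTrace 3 : ℤ) : ZMod 3) = -1 → padicValNat 3 G.tamagawaProduct = 0 →
    ∀ {N' : ℕ} [NeZero N'] (D' : ModularParametrizationData G N') (K : Type) [Field K] [NumberField K]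
      (β : ℤ) (ι : K →+* ℂ),
      N' = G.conductorNorm ℤ → IsImaginaryQuadratic K → SatisfiesHeegnerHypothesis (3 * N') K →
      Odd (NumberField.discr K) → (4 * (N' : ℤ)) ∣ β ^ 2 - NumberField.discr K → ¬ (3 : ℤ) ∣ D'.c →
      CertificateAt D' β ι 3 0

/-! ### P2 (support): level-`N` Kolyvagin–Heegner data exist wherever level-`N'` data do (CM theory) -/

/-- **P2 · `KolyvaginDataLiftThree`** (support; CM theory / existence of Heegner points of conductor `n` on
`X₀(N)` for `K` Heegner for `N`, `(n, N) = 1`, plus choices of `σ_ℓ`, `S`, embeddings — the fields of the tree's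
`KolyvaginHeegnerData`): if the companion carries a Kolyvagin–Heegner datum of conductor `n` over `(K, β, ι)`
and `4N ∣ β² − d_K`, then so does `W` at level `N`. Routine (the tree's `exists_oddHeegnerData`-type
constructions at conductor `n`); filed so that §4 is pure logic. [folklore] -/
def KolyvaginDataLiftThree : Prop :=
  ∀ (W G : WeierstrassCurve ℚ) [W.IsElliptic] [W.IsGloballyMinimal] [G.IsElliptic] [G.IsGloballyMinimal]
    {N N' : ℕ} [NeZero N] [NeZero N'] (D : ModularParametrizationData W N)
    (D' : ModularParametrizationData G N') (K : Type) [Field K] [NumberField K] (β : ℤ) (ι : K →+* ℂ)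
    (n : ℕ), IsImaginaryQuadratic K → SatisfiesHeegnerHypothesis N K →
    (4 * (N : ℤ)) ∣ β ^ 2 - NumberField.discr K → Nonempty (KolyvaginHeegnerData D' β ι n) →
    Nonempty (KolyvaginHeegnerData D β ι n)

/-! ### §4 Composition (pure logic, proved): K1 ∧ K2 ∧ P2 ⟹ the consumer's `hZ` binder with `M = 0` -/

/-- **K1 ∧ K2 ∧ P2 ⟹ Z₃ᶜ at `M = 0`.** For a corner pair `W` (`E[3]` irreducible, not surjective) with a
level-lowered companion `G` in the corner image class, Tamagawa-free and Manin-good, the `hZ` hypothesis of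
`Koly.missingPPartAt_three_of_corner_of_refinedKolyvagin_of_cornerTwist` holds with `M = 0` on EVERY odd
Heegner frame of `W` — no parity / class-number / residue-degree restriction, and regardless of
`3 ∣ Ш_an(E)`. [this sketch] -/
theorem hZ_of_kolyvaginTransport (h1 : KolyvaginTransportThree) (h2 : CompanionRefinedKolyvaginThree)
    (hP : KolyvaginDataLiftThree)
    (W G : WeierstrassCurve ℚ) [W.IsElliptic] [W.IsGloballyMinimal] [G.IsElliptic] [G.IsGloballyMinimal]
    (hirr : Irr W 3) (hc : IsLevelLoweredCompanionAtThree W G)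
    (hirrG : Irr G 3) (hnsG : ¬ Surj G 3) (ha3 : ((G.frobeniusTrace 3 : ℤ) : ZMod 3) = -1)
    (htamG : padicValNat 3 G.tamagawaProduct = 0)
    {N' : ℕ} [NeZero N'] (D' : ModularParametrizationData G N') (hN' : N' = G.conductorNorm ℤ)
    (hManinG : ¬ (3 : ℤ) ∣ D'.c) :
    ∀ [NeZero (W.conductorNorm ℤ)] (K : Type) [Field K] [NumberField K]
      (Dt : ModularParametrizationData W (W.conductorNorm ℤ)) (β : ℤ) (ι : K →+* ℂ),
      IsImaginaryQuadratic K → SatisfiesHeegnerHypothesis (W.conductorNorm ℤ) K →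
      Odd (NumberField.discr K) →
      (4 * (W.conductorNorm ℤ : ℤ)) ∣ β ^ 2 - NumberField.discr K → ¬ (3 : ℤ) ∣ Dt.c →
      ∃ M : ℕ, M ≤ padicValNat 3 W.tamagawaProduct ∧ CertificateAt Dt β ι 3 M := by
  intro _ K _ _ Dt β ι hK hHe hodd hβ hManin
  have hNW : W.conductorNorm ℤ = 3 * N' := by rw [hc.1, hN']
  -- the companion's frame: Heegner for `3·N'`, orientation divisibility `4N' ∣ β² − d_K`
  have hHe' : SatisfiesHeegnerHypothesis (3 * N') K := hNW ▸ hHe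
  have hβ' : (4 * (N' : ℤ)) ∣ β ^ 2 - NumberField.discr K := by
    refine dvd_trans ?_ hβ
    refine ⟨3, ?_⟩
    rw [hNW]; push_cast; ring
  -- K2: a level-1 certificate for the companion on this frame
  obtain ⟨n, r, d', hmem', hnd'⟩ := h2 G hirrG hnsG hc.2.1 ha3 htamG D' K β ι hN' hK hHe' hodd hβ' hManinG
  -- P2: a level-`N_W` Kolyvagin–Heegner datum of the same conductor
  obtain ⟨d⟩ := hP W G Dt D' K β ι n hK hHe hβ ⟨d'⟩
  -- K1: transport the certificate
  have hT := (h1 W G hirr hc Dt D' K rfl hN' hK hHe hodd hManin hManinG β ι n r d d').mpr ⟨hmem', hnd'⟩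
  exact ⟨0, Nat.zero_le _, n, r, d, hT.1, hT.2⟩

/-! ### §5 Audit examples: the binders are the tree's, verbatim -/

example : @CertificateAt = @Summit.BirchSwinnertonDyer.Rank1Residual.X11b.Three.Koly.CertificateAt := rfl
example : @PDiv = @Summit.BirchSwinnertonDyer.Rank1Residual.X11b.Three.Koly.PDiv := rfl
example : @MemS = @Summit.BirchSwinnertonDyer.Rank1Residual.X11b.Three.Koly.MemS := rfl

end Summit.BirchSwinnertonDyer.BirchSwinnertonDyer.Cruxes.CornerAtThreeW.KolyvaginTransport

end
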